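import Mathlib.CategoryTheory.Widesubcategory
import Literature.AnabelianGeometry.SemiGraphs.HomCategory
import Literature.AnabelianGeometry.SemiGraphs.LocallyOpenComp

/-!
# The ambient 1-category of §§4–5: totally aloof, verticially slim semi-graphs of anabelioids and locally open morphisms ([SemiAnbd] Rmk 2.4.2) — merge step M3b, part 2

Mochizuki, *Semi-graphs of anabelioids*, Publ. RIMS **42** (2006), §2 Remark 2.4.2 p.26; §4 p.50
("Let `𝔾` be a totally aloof, verticially slim semi-graph of anabelioids") (kurims
`paper:url-f33ace170ff4`). [cite: MochizukiSemiAnbd2006, Rmk 2.4.2, p. 26]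

CONSTRUCTION (L3 bridge, step M3b; cell ruling abc-iut-L3-lead 2026-08-25T20:36Z): the category
`Obj` over which the §§4–5 container `SemiAnbdVocab` (`InterfaceVocab.lean`) is parametrised —
"totally aloof, verticially slim semi-graphs of anabelioids and locally open morphisms, which the
paper treats 'as if they are simply morphisms in a category' (Rmk 2.4.2; with the correction of
[IUTchI] Rmk 2.5.3 (iii): every edge abuts to at least one vertex)":

* `isOpen_range_pi1Map_of_iso` — open image of `π₁` is invariant under 2-isomorphism of the
  pull-back functor (conjugation by a whiskered isomorphism is a homeomorphism of `Aut`), hence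
  `HomOver.IsLocallyOpen.of_iso2`: "locally open" descends to 2-isomorphism classes;
* `SgAQuot.locallyOpen : MorphismProperty SgAQuot` (a class is locally open iff some/every
  representative is) with `IsMultiplicative` (identity: `Hom.id_isLocallyOpen`; composition:
  `Hom.IsLocallyOpen.comp`, `LocallyOpenComp.lean`);
* `SgALocOpen := WideSubcategory SgAQuot.locallyOpen` and the object property `IsAmbientObj`
  (totally aloof ∧ verticially slim ∧ every edge abuts to a vertex), `SgA := its FullSubcategory` —
  a `Category` by Mathlib's instances.

Remaining bridge debt (recorded): M4 localizations `𝒢[v]`, `𝒢[e]`, `𝒢[b]` as objects of `SgA` with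
their arrows, M5 finite étale / tempered coverings, M6 verticial degrees and outer representations;
then `SemiAnbdVocab.ofReal : SemiAnbdVocab SgA`.  No printed statement is re-typed here.
-/

namespace Literature.AnabelianGeometry.SemiGraphs

open CategoryTheory CategoryTheory.PreGaloisCategory Literature.AnabelianGeometry.Anabelioids

universe v₁ u₁ u

/-! ### Open image of `π₁` is invariant under isomorphism of the pull-back functor -/

section Invariance

variable {X : Type*} [Category X] {Y : Type*} [Category Y]

/-- Conjugation by an isomorphism of functors to finite sets is continuous on automorphism groups
(Mathlib's product topologies; local copy of the private lemma of `FiberFunctorUnique.lean`).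
[folklore] -/
private theorem continuous_conjAut' {D : Type*} [Category D] {F G : D ⥤ FintypeCat.{v₁}}
    (e : F ≅ G) : Continuous e.conjAut := by
  rw [(autEmbedding_isClosedEmbedding G).isInducing.continuous_iff, continuous_pi_iff]
  intro T
  have hco : (fun σ : Aut F => autEmbedding G (e.conjAut σ) T) =
      fun σ => (e.app T).conjAut (autEmbedding F σ T) := by
    funext σ
    refine Iso.ext ?_
    simp [Iso.conj_apply, autEmbedding_apply]
  change Continuous fun σ : Aut F => autEmbedding G (e.conjAut σ) T
  rw [hco]
  exact continuous_of_discreteTopology.comp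
    ((continuous_apply T).comp (autEmbedding_isClosedEmbedding F).continuous)

/-- `π₁` at isomorphic pull-back functors: for `e : P ≅ P'`, `π₁(P') = (e ⋆ F)-conjugation ∘ π₁(P)`.
[cite: MochizukiGeoAn2004, Def. 1.1.2(ii) p.10] -/
theorem pi1Map_of_iso {P P' : Y ⥤ X} (e : P ≅ P') (F : X ⥤ FintypeCat.{v₁}) (σ : Aut F) :
    pi1Map P' F σ = (Functor.isoWhiskerRight e F).conjAut (pi1Map P F σ) := by
  refine Iso.ext (NatTrans.ext (funext fun B => ?_))
  simp only [pi1Map_hom_app, Iso.conjAut_hom, Iso.conj_apply, Functor.isoWhiskerRight_inv,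
    Functor.isoWhiskerRight_hom, NatTrans.comp_app, Functor.whiskerRight_app]
  erw [← σ.hom.naturality (e.hom.app B), ← F.map_comp_assoc, e.inv_hom_id_app, F.map_id,
    Category.id_comp]

/-- Open image of `π₁` at a basepoint is invariant under isomorphism of the pull-back functor.
[cite: MochizukiSemiAnbd2006, Def 2.2 (ii), p. 24] -/
theorem isOpen_range_pi1Map_of_iso {P P' : Y ⥤ X} (e : P ≅ P') (F : X ⥤ FintypeCat.{v₁})
    (h : IsOpen (Set.range (pi1Map P F))) : IsOpen (Set.range (pi1Map P' F)) := by
  have hset : Set.range (pi1Map P' F) =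
      (Functor.isoWhiskerRight e.symm F).conjAut ⁻¹' Set.range (pi1Map P F) := by
    ext τ
    constructor
    · rintro ⟨σ, rfl⟩
      exact ⟨σ, pi1Map_of_iso e.symm F σ⟩
    · rintro ⟨σ, hσ⟩
      refine ⟨σ, (Functor.isoWhiskerRight e.symm F).conjAut.injective ?_⟩
      rw [← pi1Map_of_iso e.symm F σ]
      exact hσ
  rw [hset]
  exact h.preimage (continuous_conjAut' _)

end Invariance

namespace SemiGraphOfAnabelioids

variable {𝒢 ℋ : SemiGraphOfAnabelioids.{v₁, u₁, u}} {f : 𝒢.graph ⟶ ℋ.graph}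

/-- The 1-morphism underlying a composite over composable bases is the composite 1-morphism
(bookkeeping `rfl`, used to avoid a slow definitional unfolding). [cite: MochizukiSemiAnbd2006, Rmk 2.4.2, p. 26] -/
theorem HomOver.comp_toHom {𝒦 : SemiGraphOfAnabelioids.{v₁, u₁, u}} {g : ℋ.graph ⟶ 𝒦.graph}
    (φ : HomOver 𝒢 ℋ f) (ψ : HomOver ℋ 𝒦 g) : (φ.comp ψ).toHom = φ.toHom.comp ψ.toHom := rfl

/-- "Locally open" descends to 2-isomorphism classes of 1-morphisms.
[cite: MochizukiSemiAnbd2006, Def 2.2 (ii), p. 24] -/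
theorem HomOver.IsLocallyOpen.of_iso2 {φ φ' : HomOver 𝒢 ℋ f} (σ : HomOver.Iso2 φ φ')
    (h : φ.toHom.IsLocallyOpen) : φ'.toHom.IsLocallyOpen :=
  ⟨fun v F _ => isOpen_range_pi1Map_of_iso (σ.isoV v) F (h.1 v F),
    fun e F _ => isOpen_range_pi1Map_of_iso (σ.isoE e (f.edgeMap e) rfl) F (h.2 e F)⟩

end SemiGraphOfAnabelioids

/-! ### The wide subcategory of locally open arrows, the full subcategory of ambient objects -/

namespace SgAQuot

open SemiGraphOfAnabelioids

/-- An arrow of the Rmk 2.4.2 category is *locally open* if its representatives are locally open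
1-morphisms (well defined by `HomOver.IsLocallyOpen.of_iso2`).
[cite: MochizukiSemiAnbd2006, Def 2.2 (ii), p. 24] -/
def locallyOpen : MorphismProperty SgAQuot.{v₁, u₁, u} := fun X Y a =>
  Quotient.liftOn a.cls (fun φ : HomOver X.toSgA Y.toSgA a.base => φ.toHom.IsLocallyOpen)
    (fun _ _ h => by
      obtain ⟨σ⟩ := h
      exact propext ⟨HomOver.IsLocallyOpen.of_iso2 σ, HomOver.IsLocallyOpen.of_iso2 σ.symm⟩)

/-- The class of `φ` is locally open iff `φ` is. [cite: MochizukiSemiAnbd2006, Def 2.2 (ii), p. 24] -/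
theorem homMk_mem_locallyOpen_iff {X Y : SgAQuot.{v₁, u₁, u}} {f : X.toSgA.graph ⟶ Y.toSgA.graph}
    (φ : HomOver X.toSgA Y.toSgA f) : locallyOpen (homMk φ) ↔ φ.toHom.IsLocallyOpen :=
  Iff.rfl

/-- Locally open arrows contain the identities and are stable under composition.
[cite: MochizukiSemiAnbd2006, Rmk 2.4.2, p. 26] -/
instance : locallyOpen.{v₁, u₁, u}.IsMultiplicative where
  id_mem X := (homMk_mem_locallyOpen_iff (HomOver.id X.toSgA)).mpr (Hom.id_isLocallyOpen X.toSgA)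
  comp_mem a b ha hb := by
    obtain ⟨f, a⟩ := a
    obtain ⟨g, b⟩ := b
    induction a using Quotient.ind with
    | _ φ =>
      induction b using Quotient.ind with
      | _ ψ =>
        have hφ := (homMk_mem_locallyOpen_iff φ).mp ha
        have hψ := (homMk_mem_locallyOpen_iff ψ).mp hb
        have key : (φ.comp ψ).toHom.IsLocallyOpen := by
          rw [HomOver.comp_toHom]; exact hφ.comp hψ
        exact (homMk_mem_locallyOpen_iff (φ.comp ψ)).mpr key

-- justification: as for `SemiGraphOfAnabelioids` / `SgAQuot`, the three universes occur only
-- together in the wrapped structure's type.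
set_option linter.checkUnivs false in
/-- Semi-graphs of anabelioids with LOCALLY OPEN arrows (2-isomorphism classes): the wide
subcategory of `SgAQuot`. [cite: MochizukiSemiAnbd2006, Rmk 2.4.2, p. 26] -/
abbrev SgALocOpen : Type (max (u + 1) (u₁ + 1) (v₁ + 1)) := WideSubcategory locallyOpen.{v₁, u₁, u}

/-- The objects of the ambient category of §§4–5: "totally aloof, verticially slim semi-graphs of
anabelioids" (§4 p.50, Rmk 2.4.2) in which every edge abuts to at least one vertex ([IUTchI]
Rmk 2.5.3 (iii)). [cite: MochizukiSemiAnbd2006, Rmk 2.4.2, p. 26] -/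
def IsAmbientObj : ObjectProperty SgALocOpen.{v₁, u₁, u} := fun X =>
  X.obj.toSgA.IsTotallyAloof ∧ X.obj.toSgA.IsVerticiallySlim ∧ X.obj.toSgA.EveryEdgeAbuts

-- justification: as above (universes of the wrapped structure occur only together).
set_option linter.checkUnivs false in
/-- **The ambient 1-category of [SemiAnbd] §§4–5**: totally aloof, verticially slim semi-graphs
of anabelioids (every edge abutting to a vertex) with locally open morphisms regarded up to
2-isomorphism (Rmk 2.4.2) — a full subcategory of a wide subcategory of `SgAQuot`, a `Category` by
Mathlib's instances.  The intended `Obj` of `SemiAnbdVocab.ofReal` (merge steps M4–M6 pending).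
[cite: MochizukiSemiAnbd2006, Rmk 2.4.2, p. 26] -/
abbrev SgA : Type (max (u + 1) (u₁ + 1) (v₁ + 1)) := IsAmbientObj.{v₁, u₁, u}.FullSubcategory

/-- The underlying semi-graph of anabelioids of an object of the ambient category.
[cite: MochizukiSemiAnbd2006, Rmk 2.4.2, p. 26] -/
abbrev SgA.toSgA (X : SgA.{v₁, u₁, u}) : SemiGraphOfAnabelioids.{v₁, u₁, u} := X.obj.obj.toSgA

/-- The forgetful functor from the ambient category to semi-graphs.
[cite: MochizukiSemiAnbd2006, Rmk 2.4.2, p. 26] -/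
noncomputable def SgA.forgetToSemiGraph : SgA.{v₁, u₁, u} ⥤ SemiGraph.{u} :=
  IsAmbientObj.ι ⋙ wideSubcategoryInclusion _ ⋙ SgAQuot.forgetToSemiGraph

end SgAQuot

end Literature.AnabelianGeometry.SemiGraphs
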